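import Mathlib
import HarnessLib
import Literature.Analysis.FluidPDE.VorticityCalculus
import Summits.NavierStokesRegularity.NavierStokesRegularity.Theorems.AxisTwistDoorAveragedConeLiouvilleDefs
import Summits.NavierStokesRegularity.NavierStokesRegularity.Theorems.AxisTwistDoorAveragedConeLiouvilleCircleStokes

/-!
# Crux `AxisTwistDoor.AveragedConeLiouville` (stmt-NavierStokesRegularity-26889), line `lrt_shell` (LEAD ns-atd-p1 g0): bricks C1–C3 —
# the axis circulation as the integral of the vertical-vorticity circulation, its SIGN and MONOTONICITY in `r`, and the disc bound
# `∫₀^R ∮|ω_h| ≤ K Γ(R)` under the circle-averaged cone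

Route `AxisTwistDoor` (NavierStokesRegularity), crux 26889 `AveragedConeLiouville`, line `lrt_shell` (v3 = v2 with the vocabulary of
`…Theorems.AxisTwistDoorAveragedConeLiouvilleDefs`).  Helper bricks requested by the LEAD (ideators INBOX 2026-08-28T09:36:51Z) for stubs (5)
`stub_fluxDecay` and (6) `stub_regularOfFluxDecay`, with the slice regularity `ContDiff ℝ 1 (v s)` as an explicit hypothesis (discharged by the
LEAD from the class), on top of ns-ezl-w3's Stokes relation `∂ᵣΓ = ∮ω₃ dl` (`…CircleStokes.hasDerivAt_circ`):

* C1 `circ_zero`, `continuous_vortCirc`, `circ_eq_integral_vortCirc` — `Γ(0,z,s) = 0` and `Γ(R,z,s) = ∫₀^R ∮_{S(ρ,z)} ω₃ dl dρ` (FTC in `r`);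
* C2 `vortCirc_nonneg`, `circ_nonneg`, `circ_mono` — under the sign `ω₃ ≥ 0` (`SignE3`): `∮ω₃ dl ≥ 0`, `Γ ≥ 0` and `Γ` is non-decreasing in
  `r ≥ 0` (the monotonicity that is load-bearing in LRT §4: the flux through a disc grows with the disc);
* C3 `tiltCirc_zero`, `continuous_tiltCirc`, `integral_tiltCirc_le` — if `∮_{S(ρ,z)}|ω_h| dl ≤ K ∮_{S(ρ,z)} ω₃ dl` for every `ρ > 0` (the
  circle-averaged cone) then `∫₀^R ∮|ω_h| dl dρ ≤ K Γ(R,z,s)` (the disc-`L¹` bound on the horizontal vorticity that stub (6) consumes).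

WHAT THIS IS NOT: not NS regularity, not the crux — helpers `--supports stmt-NavierStokesRegularity-26889 --as helper` (width seat ns-cas-k2 g0,
DIRECTOR-NS #193 (1) / #194 (2)); ACL 26889, the leaf `HalfSpaceWindowDoor.Target` and NS regularity are OPEN.
[cite: LeiRenTian2025, §4 pp. 11–12 (monotonicity of Γ in r; disc flux)]
-/

noncomputable section

set_option linter.dupNamespace false

namespace Summit.NavierStokesRegularity.NavierStokesRegularity.Theorems.AveragedConeLiouville.CircMonotone

open scoped Topology InnerProductSpace
open Set Function MeasureTheory intervalIntegral
open Literature.Analysis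
open Literature.Analysis.FluidPDE hiding eR
open Summit.NavierStokesRegularity.NavierStokesRegularity.Theorems.AxisTwistDoorAveragedConeLiouvilleDefs
open Summit.NavierStokesRegularity.NavierStokesRegularity.Theorems.AveragedConeLiouville.CircleStokes

variable (v : ℝ → EuclideanSpace ℝ (Fin 3) → EuclideanSpace ℝ (Fin 3))

/-! ### C1: `Γ(0) = 0` and `Γ(R) = ∫₀^R ∮ω₃` -/

/-- `Γ(0, z, s) = 0` (the integrand carries the factor `r = 0`). [folklore] -/
theorem circ_zero (z s : ℝ) : circ v 0 z s = 0 := by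
  simp [circ]

/-- `∮_{S(0,z)} ω₃ dl = 0` likewise. [folklore] -/
theorem vortCirc_zero (z s : ℝ) : vortCirc v 0 z s = 0 := by
  simp [vortCirc]

/-- `∮_{S(0,z)} |ω_h| dl = 0` likewise. [folklore] -/
theorem tiltCirc_zero (z s : ℝ) : tiltCirc v 0 z s = 0 := by
  simp [tiltCirc]

/-- `r ↦ ∮_{S(r,z)} ω₃ dl` is continuous for a `C¹` slice (a parametric integral of a jointly continuous integrand). [folklore] -/
theorem continuous_vortCirc {s : ℝ} (hv : ContDiff ℝ 1 (v s)) (z : ℝ) : Continuous fun r => vortCirc v r z s := by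
  have hp : Continuous fun q : ℝ × ℝ => cylPt q.1 q.2 z :=
    (contDiff_cylPt z (n := 0)).continuous.comp (continuous_snd.prodMk continuous_fst)
  have hω : Continuous fun q : ℝ × ℝ => curl (v s) (cylPt q.1 q.2 z) := (continuous_curl hv).comp hp
  have hF : Continuous (Function.uncurry fun r θ : ℝ => ⟪curl (v s) (cylPt r θ z), e3⟫_ℝ * r) :=
    (hω.inner continuous_const).mul continuous_fst
  have h := intervalIntegral.continuous_parametric_intervalIntegral_of_continuous' (μ := volume) hF 0 (2 * Real.pi)
  exact h

/-- `r ↦ ∮_{S(r,z)} |ω_h| dl` is continuous for a `C¹` slice. [folklore] -/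
theorem continuous_tiltCirc {s : ℝ} (hv : ContDiff ℝ 1 (v s)) (z : ℝ) : Continuous fun r => tiltCirc v r z s := by
  have hp : Continuous fun q : ℝ × ℝ => cylPt q.1 q.2 z :=
    (contDiff_cylPt z (n := 0)).continuous.comp (continuous_snd.prodMk continuous_fst)
  have hω : Continuous fun q : ℝ × ℝ => curl (v s) (cylPt q.1 q.2 z) := (continuous_curl hv).comp hp
  have hω3 : Continuous fun q : ℝ × ℝ => ⟪curl (v s) (cylPt q.1 q.2 z), e3⟫_ℝ := hω.inner continuous_const
  have hh : Continuous fun q : ℝ × ℝ => curl (v s) (cylPt q.1 q.2 z) - ⟪curl (v s) (cylPt q.1 q.2 z), e3⟫_ℝ • e3 :=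
    hω.sub (hω3.smul continuous_const)
  have hF' : Continuous fun q : ℝ × ℝ => ‖curl (v s) (cylPt q.1 q.2 z) - ⟪curl (v s) (cylPt q.1 q.2 z), e3⟫_ℝ • e3‖ * q.1 :=
    hh.norm.mul continuous_fst
  have hF : Continuous (Function.uncurry fun r θ : ℝ =>
      ‖curl (v s) (cylPt r θ z) - ⟪curl (v s) (cylPt r θ z), e3⟫_ℝ • e3‖ * r) := hF'
  have h := intervalIntegral.continuous_parametric_intervalIntegral_of_continuous' (μ := volume) hF 0 (2 * Real.pi)
  exact h

/-- **C1: `Γ(R, z, s) = ∫₀^R ∮_{S(ρ,z)} ω₃ dl dρ`** for a `C¹` slice and every `R` (FTC with `∂ᵣΓ = ∮ω₃ dl`, `…CircleStokes.hasDerivAt_circ`,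
and `Γ(0) = 0`). [cite: LeiRenTian2025, §4 p. 11 (Γ = ∫_D ω₃ by Stokes)] -/
theorem circ_eq_integral_vortCirc {s : ℝ} (hv : ContDiff ℝ 1 (v s)) (z R : ℝ) :
    circ v R z s = ∫ ρ in (0 : ℝ)..R, vortCirc v ρ z s := by
  rw [integral_eq_sub_of_hasDerivAt (fun ρ _ => hasDerivAt_circ v hv ρ z) ((continuous_vortCirc v hv z).intervalIntegrable _ _),
    circ_zero, sub_zero]

/-- `Γ(r₂) − Γ(r₁) = ∫_{r₁}^{r₂} ∮ω₃` (FTC between two radii). [folklore] -/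
theorem circ_sub_circ_eq_integral {s : ℝ} (hv : ContDiff ℝ 1 (v s)) (z r₁ r₂ : ℝ) :
    circ v r₂ z s - circ v r₁ z s = ∫ ρ in r₁..r₂, vortCirc v ρ z s :=
  (integral_eq_sub_of_hasDerivAt (fun ρ _ => hasDerivAt_circ v hv ρ z) ((continuous_vortCirc v hv z).intervalIntegrable _ _)).symm

/-! ### C2: sign and monotonicity -/

/-- **`∮_{S(r,z)} ω₃ dl ≥ 0`** for `r ≥ 0` under the sign `ω₃ ≥ 0` (no regularity needed). [folklore] -/
theorem vortCirc_nonneg {s : ℝ} (hsign : SignE3 v) (hs : s < 0) {r : ℝ} (hr : 0 ≤ r) (z : ℝ) : 0 ≤ vortCirc v r z s := by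
  unfold vortCirc
  exact intervalIntegral.integral_nonneg (by positivity) fun θ _ => mul_nonneg (hsign s hs _) hr

/-- **`Γ(R, z, s) ≥ 0`** for `R ≥ 0`, a `C¹` slice and the sign `ω₃ ≥ 0`. [folklore] -/
theorem circ_nonneg {s : ℝ} (hv : ContDiff ℝ 1 (v s)) (hsign : SignE3 v) (hs : s < 0) {R : ℝ} (hR : 0 ≤ R) (z : ℝ) :
    0 ≤ circ v R z s := by
  rw [circ_eq_integral_vortCirc v hv z R]
  exact intervalIntegral.integral_nonneg hR fun ρ hρ => vortCirc_nonneg v hsign hs hρ.1 z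

/-- **C2: `Γ` IS NON-DECREASING IN `r ≥ 0`** for a `C¹` slice under the sign `ω₃ ≥ 0`: `0 ≤ r₁ ≤ r₂ ⇒ Γ(r₁,z,s) ≤ Γ(r₂,z,s)` (the flux through a
disc grows with the disc). [cite: LeiRenTian2025, §4 p. 11 (monotonicity of Γ in r)] -/
theorem circ_mono {s : ℝ} (hv : ContDiff ℝ 1 (v s)) (hsign : SignE3 v) (hs : s < 0) {r₁ r₂ : ℝ} (h0 : 0 ≤ r₁) (h : r₁ ≤ r₂)
    (z : ℝ) : circ v r₁ z s ≤ circ v r₂ z s := by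
  have hint : 0 ≤ ∫ ρ in r₁..r₂, vortCirc v ρ z s :=
    intervalIntegral.integral_nonneg h fun ρ hρ => vortCirc_nonneg v hsign hs (h0.trans hρ.1) z
  have := circ_sub_circ_eq_integral v hv z r₁ r₂
  linarith

/-- `Γ` is monotone on `[0, ∞)` (the `MonotoneOn` form of C2). [folklore] -/
theorem monotoneOn_circ {s : ℝ} (hv : ContDiff ℝ 1 (v s)) (hsign : SignE3 v) (hs : s < 0) (z : ℝ) :
    MonotoneOn (fun r => circ v r z s) (Ici 0) :=
  fun _ h₁ _ _ h => circ_mono v hv hsign hs h₁ h z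

/-! ### C3: the disc bound on the horizontal vorticity under the circle-averaged cone -/

/-- **C3: `∫₀^R ∮_{S(ρ,z)} |ω_h| dl dρ ≤ K Γ(R, z, s)`** if `∮|ω_h| dl ≤ K ∮ω₃ dl` on every circle of positive radius (the circle-averaged cone;
on `ρ = 0` both sides vanish), `K ≥ 0`, `R > 0`, for a `C¹` slice. [cite: LeiRenTian2025, §3 Lemma 3.2 / §4 (∫_D |ω| ≤ (1+K) Γ)] -/
theorem integral_tiltCirc_le {s : ℝ} (hv : ContDiff ℝ 1 (v s)) {K : ℝ} (hK : 0 ≤ K) {R : ℝ} (hR : 0 < R) (z : ℝ)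
    (hcone : ∀ ρ : ℝ, 0 < ρ → tiltCirc v ρ z s ≤ K * vortCirc v ρ z s) :
    ∫ ρ in (0 : ℝ)..R, tiltCirc v ρ z s ≤ K * circ v R z s := by
  have _ := hK
  calc ∫ ρ in (0 : ℝ)..R, tiltCirc v ρ z s ≤ ∫ ρ in (0 : ℝ)..R, K * vortCirc v ρ z s := by
        refine intervalIntegral.integral_mono_on hR.le ((continuous_tiltCirc v hv z).intervalIntegrable _ _)
          ((continuous_const.mul (continuous_vortCirc v hv z)).intervalIntegrable _ _) fun ρ hρ => ?_
        rcases hρ.1.eq_or_lt with h0 | hpos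
        · rw [← h0, tiltCirc_zero, vortCirc_zero, mul_zero]
        · exact hcone ρ hpos
    _ = K * circ v R z s := by rw [intervalIntegral.integral_const_mul, circ_eq_integral_vortCirc v hv z R]

end Summit.NavierStokesRegularity.NavierStokesRegularity.Theorems.AveragedConeLiouville.CircMonotone

end
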